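import Mathlib
import HarnessLib
import HarnessLib.Audit
import Summits.Parity.Statement
import Literature.NumberTheory.Sieve.CubicMinorantDefs
import Literature.NumberTheory.Sieve.HeathBrownWeightClassSums
import HarnessLib.Audit.Status.Attr

/-!
Route: RomanoffHeathBrown

CLOSED (proved) 2026-08-27T13:34:35Z by planner-parity-ideate-p2-g10-0 — reason: proved:Summit.Parity.GeneralizedHardyLittlewood.Theses.RomanoffHeathBrown.goldbachHeathBrownPositiveDensity_proof — note: PROVED close (tenure, precedent routes E/F 2026-08-26): target stmt-Parity-20271 GoldbachHeathBrownPositiveDensity closed proved 13:10:12Z by goldbachHeathBrownPositiveDensity_proof (p533161, prover parity-romanoff-p2 g0) = closes(assembly_proof p532491, smallModuliCorrelation p531506, largeModuliCo. The file is kept as the record of this route; refuted decls are indexed as negative knowledge (`ledger negatives`).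

# Route RomanoffHeathBrown — a positive proportion of even n are p + π with π = x³+2y³ a Heath-Brown
prime, by Romanoff's second moment

X = the five blocks of ROMANOFF's second-moment (energy) argument for the sumset P + A, A = the
Heath-Brown primes
π = x³ + 2y³ with (x, y) in Heath-Brown's box (X, X(1+η)]², X = (N/6)^(1/3), η = (log X)^(−c)
(weight `CubicMinorant.hbWeight c N`,
a set of N^(2/3−o(1)) primes ≤ N): X = SmallModuliCorrelation ∧ LargeModuliCorrelation ∧ HBMassLower
∧ SecondMomentReduction ∧ Assembly.
It suffices to show X: with R(n) = Σ_(k+m=n) u(k)·θ_N(m) (u the Heath-Brown weight, θ_N = log on the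
odd primes ≤ N) one has
Σ_(n≤2N) R(n) = U·(θ(N) − log 2) ≫ N·U (HBMassLower gives U ≫ η²N; Chebyshev), while Σ_(n≤2N) R(n)²
≪ η²N²·U: the pair sieve
(tree `primePairs_card_le` / `PrimePairSieve.primePairs_card_le_four`, uniform in the shift) and the
divisor switch
h/φ(h) = Σ_(d|h) μ²(d)/φ(d) reduce the off-diagonal to the class energies Σ_d g(d) Σ_(r mod d)
U_d(r)² of the Heath-Brown weight
(SecondMomentReduction), which are ≪ η²N·U on the moduli d ≤ √(ηX) by the tree's Brun–Titchmarsh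
bound for prime values of x³+2y³ on
residue classes of pairs (SmallModuliCorrelation) and o(η²N·U) beyond by lattice counts and Rankin
tails (LargeModuliCorrelation).
Cauchy–Schwarz (Assembly) gives ≫ N even n ≤ 2N with R(n) > 0, i.e. n = p + π — the rung leaf
`GoldbachHeathBrownPositiveDensity`
(D-0061 rung F-P1c of Parity, cell parity-ideate seat p2, Line D/g8; target item rank 0, to be
registered as an ALT-CLOSER; implied in
one line by the registered leaf F-P1b `GoldbachHeathBrownDispersion.GoldbachHeathBrownAlmostAll`;
never summit credit).
Lean: `Summit.Parity.GeneralizedHardyLittlewood.Theses.RomanoffHeathBrown.SmallModuliCorrelation ∧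
Summit.Parity.GeneralizedHardyLittlewood.Theses.RomanoffHeathBrown.LargeModuliCorrelation ∧
Summit.Parity.GeneralizedHardyLittlewood.Theses.RomanoffHeathBrown.HBMassLower ∧
Summit.Parity.GeneralizedHardyLittlewood.Theses.RomanoffHeathBrown.SecondMomentReduction ∧
Summit.Parity.GeneralizedHardyLittlewood.Theses.RomanoffHeathBrown.Assembly`

## Assembly
Romanoff's Cauchy–Schwarz, ε-free: take c, c₁ from HBMassLower; C_S from SmallModuliCorrelation(c);
LargeModuliCorrelation(c) at ε = 1;
C_R from SecondMomentReduction(c); for N beyond all thresholds Σ_(n≤2N) R(n)² ≤ C_R(N log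
N)N^(1/3)log N(ηX+2)U + C_R N(C_S+1)η²N·U
≤ C′η²N²U, because (log N)²N^(4/3)(ηX+2) = o(η²N²) for X = (N/6)^(1/3), η = (log X)^(−c); Σ_(n≤2N)
R(n) = U(θ(N) − log 2) ≥ UN/2
(Mathlib `Chebyshev.theta_ge`); R(n) ≠ 0 forces n = k + m with u(k) ≠ 0 (so k = x³+2y³ prime, x, y >
X ≥ 1, k odd) and m an odd
prime, hence n even and represented; Cauchy–Schwarz over the support (tree
`Romanov.card_sq_le_card_image_mul_card_filter` /
`sq_sum_le_card_mul_sum_sq`) gives #(n ≤ 2N represented) ≥ (UN/2)²/(C′η²N²U) = U/(4C′η²) ≥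
(c₁/4C′)N, and N ↦ ⌊N/2⌋ converts to the
target's n ≤ N with c₀ = c₁/(16C′). The deciding theorem `closes` applies the Assembly item to the
four blocks (all five items in its cone).

CLOSES_TARGET: closes rung F-P1c of Parity: Summit.Parity.GeneralizedHardyLittlewood.Theses.RomanoffHeathBrown.GoldbachHeathBrownPositiveDensity (D-0061; not the summit Statement) — the deciding theorem of this route concludes that registered leaf instead of the Statement decl `GeneralizedHardyLittlewood` (class rung: servable and labelled, never counted as concluding the summit Statement).

Rationale: WHY THIS LINE. Mechanism: Romanoff's theorem (Romanoff1934; Nathanson1996 §7.6; Erdos1950) proves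
positive lower density of P + A for a THIN set A
from two inputs only — an upper-bound sieve for prime pairs uniform in the shift, and an ℓ²-bound
for A in residue classes weighted by
the singular series — and both exist in the tree for A = the Heath-Brown primes: the pair sieve
(`Literature.NumberTheory.Sieve.primePairs_card_le`,
`PrimePairSieve.primePairs_card_le_four`, and the whole template `RomanovTheorem.lean` §§5–6 incl.
`Romanov.card_sq_le_card_image_mul_card_filter`),
the class Brun–Titchmarsh bound for prime values of x³+2y³ on residue classes of pairs
(`CubicMinorant.sum_hbWeight_modEq_le`, HeathBrownMoroz2004
Lemma 2.4/§3 shape, lit seat g14), the local counts ν_d(r) ≤ 3^ω(d)·d, cw(d) ≤ 2^ω(d), the lattice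
count of box pairs on a class
(`CubicFormClassCountBounds`), Rankin tails (`RoughModelDispersionTailSums`) and Heath-Brown's
asymptotic for the mass (HeathBrownActa2001,
kernel theorem `HeathBrown2001_primePairCount_asymptotic_holds`). Arithmetic input on A is genuinely
necessary: for a general set of
x^α elements satisfying only growth conditions the sumset with P can have density ≍ 1/logloglog x,
sharply (Ding, quoted in arXiv:2401.15892 p. 3),
so the content of the line is that UPPER bounds of the right order in classes to moduli ≤ √(ηX) — no
asymptotics, no level of distribution,
no exponential sums — already give positive density. Imported: the additive-combinatorial energy
method for thin sets (Romanoff/Erdős,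
arXiv:0708.2539, arXiv:2401.15892) onto cubic-field sieve bounds. What it does that the sibling
route does not: `GoldbachHeathBrownDispersion`
(rung F-P1b, ALMOST ALL n) is idea-bound on Heath-Brown–Moroz class ASYMPTOTICS with a class-uniform
box exponent (its K1, XL, not in
print as needed); this line gives up density one for positive density and is fact-free and
work-bound — every block is a consequence of
tree theorems along a written proof. No refuted Parity statement (negatives index: 4) is used or
approached.

RANKED CRUXES. #0 GoldbachHeathBrownPositiveDensity (target) — there are c₀ > 0 and N₀ such that for
all N ≥ N₀ at least c₀N even integers n ≤ N are p + (x³+2y³) with p and x³+2y³ prime, x, y ≥ 1. (why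
it might fail: a density-zero sumset would need the Heath-Brown primes to concentrate on few residue
classes to many small moduli (Ding-type examples, arXiv:2401.15892 p. 3) — excluded by the class
Brun–Titchmarsh bound; numerically untested.) [Romanoff1934, Nathanson1996, HeathBrownActa2001,
arXiv:2401.15892]
#2 SmallModuliCorrelation (crux) — SMALL-MODULI CLASS ENERGY of the Heath-Brown weight u = hbWeight
c N (U = Σ_(k≤N) u(k), U_d(r) = Σ_(k≤N, k≡r (d)) u(k), g(d) = ∏_(p|d) 1/(p−2)): for every c > 0
there are C, N₀ with Σ_(d ≤ √(ηX), d odd squarefree) g(d)·Σ_(r mod d) U_d(r)² ≤ C·(η²N)·U for N ≥ N₀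
— from U_d(r) ≤ C₁6^ω(d)η²N/d (class Brun–Titchmarsh, tree `sum_hbWeight_modEq_le`, with ν_d(r) ≤
3^ω(d)d, cw(d) ≤ 2^ω(d), log(hbSide/d) ≥ (1/13)log N, non-coprime classes empty) and Σ_d
g(d)6^ω(d)/d < ∞. [difficulty: M] (why it might fail: needs the tree bound's threshold L₀ ≤ hbSide/d
and log(hbSide/d) ≫ log N UNIFORMLY for d ≤ √(ηX), and empty non-coprime classes (every Heath-Brown
prime > N/2 > d); the d = 1 term alone forces U ≤ Cη²N (true, HeathBrownActa2001) — a mis-normalised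
η²N vs N^(1/3)·hbSide² would break only constants.) [HeathBrownMoroz2004, HeathBrownActa2001,
HalberstamRichert1974, Nathanson1996]
#3 LargeModuliCorrelation (crux) — LARGE-MODULI CLASS ENERGY: for every c > 0 and ε > 0, for N ≥ N₀,
Σ_(√(ηX) < d ≤ N, d odd squarefree) g(d)·Σ_(r mod d) U_d(r)² ≤ ε·(η²N)·U — by the lattice count
U_d(r) ≤ N^(1/3) log N·3^ω(d)(ηX+2)((ηX+1)/d + 1) (for each y the x with x³ ≡ r − 2y³ lie in ≤
3^ω(d) classes mod squarefree d; tree `card_Ioc_filter_cube_modEq_le`), g(d) ≤ 3^ω(d)/d, the Rankin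
tail Σ_(d>D) 9^ω(d)/d² ≪ D^(−1/2) and Σ_(d≤N) 9^ω(d)/d ≪ (log N)^9: total N^(11/12+o(1))·U =
o(η²N·U). [difficulty: M] (why it might fail: the lattice count has no log saving, so the exponent
budget 1/3 + 1/3 + (1/3)(3/4) = 11/12 < 1 is the whole margin (N^(1/12−o(1))); a d-range where only
ν_d(r)(L/d+1)² (tree `card_pairBox_modEq_le`) were available would give N^(4/3) and break it — the
one-y-at-a-time count is essential.) [HalberstamRichert1974, MontgomeryVaughan2007,
HeathBrownMoroz2004, arXiv:0708.2539]
#9 HBMassLower (support) — MASS of the Heath-Brown weight: there are a box exponent c > 0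
(Heath-Brown's), c₁ > 0 and N₀ with U = Σ_(k≤N) hbWeight c N k ≥ c₁·η²N for N ≥ N₀ — from the kernel
theorem `CubicPrimes.HeathBrown2001_primePairCount_asymptotic_holds` (#primePairs ~ σ₀η²X²/(3 log
X), X³ = N/6) exactly as in the Theorems file `HeathBrownPrimeAP3.mass_ge` /
`VinogradovHeathBrownMainTerm` (have hmass). [difficulty: S] [HeathBrownActa2001,
HeathBrownMoroz2004]
#9 SecondMomentReduction (support) — PAIR-SIEVE REDUCTION of the second moment: with θ_N(m) = log m
on odd primes m ≤ N (else 0) and R(n) = Σ_(k≤N) u(k)θ_N(n−k), for every c > 0 there are C, N₀ with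
Σ_(n≤2N) R(n)² ≤ C·(N log N)·(N^(1/3) log N·(ηX+2))·U + C·N·Σ_(d≤N odd squarefree) g(d) Σ_(r mod d)
U_d(r)² (N ≥ N₀): diagonal T(0) = Σ_(p≤N)(log p)² ≤ log 4·N log N (Mathlib
`Chebyshev.theta_le_log4_mul_x`) times max u ≤ N^(1/3) log N·(ηX+2); a shift h = |k−k′| ≥ 1 costs ≤
(log N)²·#(p ≤ N : p+h prime) ≤ C·N·h/φ(h) (tree `primePairs_card_le`; or 𝔖(h) via
`PrimePairSieve.primePairs_card_le_four`) and h/φ(h) = Σ_(d|h) μ²(d)/φ(d) ≤ 2Σ_(d|h, d odd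
squarefree) g(d) (tree `Romanov.selfDivTotient_eq_sum_divisors`); dropping k ≠ k′ gives the class
energies — the tree's `RomanovTheorem.lean` §5 (`card_primePairsShift_le`,
`card_primePowTwoQuadruples_le`) is the template. [difficulty: M] [Nathanson1996, Romanoff1934,
BombieriDavenport1966, MontgomeryVaughan2007, arXiv:0708.2539]

TWO-LAYER PLAN. SmallModuliCorrelation ⇐ ClassSupSmall (U_d(r) ≤ C₁6^ω(d)η²N/d for odd squarefree d
≤ √(ηX), all r) → EulerSumSix (Σ_d g(d)6^ω(d)/d ≤ M) →
SmallModuliCorrelation (Σ_r U_d(r)² ≤ sup_r U_d(r)·U); LargeModuliCorrelation ⇐ ClassSupLattice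
(U_d(r) ≤ N^(1/3)log N·3^ω(d)(ηX+2)((ηX+1)/d+1),
every squarefree d) → LargeTailSmall (the d-sum beyond √(ηX) is ≤ εη²N after the N^(1/3)log N(ηX+2)
factor) → LargeModuliCorrelation — both
registered as BC3 birth skeletons (bc/*_birth.lean, 3 stubs each, kernel-checked compositions);
filed by split once a prover claims the parent.

KILL CRITERIA. No refutation of a block kills the MECHANISM: each block is a consequence of tree
theorems along the written proof (class Brun–Titchmarsh,
lattice counts, Rankin tails, Heath-Brown's asymptotic, the pair sieve), so a refutation of
SmallModuliCorrelation / LargeModuliCorrelation /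
SecondMomentReduction as typed means a mis-normalised constant or threshold (class misstated ⇒
restate with the repaired normalisation,
e.g. N^(1/3)·hbSide² log N/log hbSide in place of η²N). The route is closed superseded the moment
the sibling leaf F-P1b
`GoldbachHeathBrownDispersion.GoldbachHeathBrownAlmostAll` is proved (it implies the target in one
line), and is pointless if the director
declines to register the leaf as rung F-P1c (then: close not-a-thesis, keep the items as supports of
the sibling).

NOT DECOMPOSED YET. The per-class sup bounds, the Euler/Rankin sums, the ℓ²-to-sup step, the
identity Σ_n R(n) = U·(θ(N) − log 2), the o(η²N²) comparison of the
diagonal and the ⌊N/2⌋ conversion are layer-2 children (Two-layer plan / BC3 skeletons) or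
prover-level lemmas; all constants (C, C₁, c₁, C_R)
are deliberately existential (typing checklist 4c(iv)); the split point √(ηX) is fixed in both
cruxes so that they tile the d-range exactly.

CHEAPEST FALSIFIER. (1) The d = 1 instance of SmallModuliCorrelation reads U ≤ C·η²N: consistent
with Heath-Brown's asymptotic U ~ σ₀6^(−2/3)η²N·(log N)/(3 log X)
— wait-free lookup in the tree (`mass_ge`, `sum_hbRep_eq`,
`HeathBrown2001_primePairCount_asymptotic_holds`): passes (U ≍ η²N up to constants,
since log N/log X = 3 + o(1)). (2) Exponent bookkeeping of LargeModuliCorrelation: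
N^(1/3)·(ηX)·(ηX)^(3/4) = N^(11/12+o(1)) against η²N —
checked by hand (NOTES.md ## TRACK R4), margin N^(1/12). (3) In-Lean: the BC2/BC7 probes (all cheap
closings fail; no vacuity). (4) One kit
job NOT run (not needed for a work-bound line): count the even n ≤ 2·10⁷ of the form p + π with π a
Heath-Brown prime of the box at N = 10⁷.

NUMBERS. Heath-Brown primes in the box: #primePairs(X, η) = σ₀η²X²/(3 log X)(1 + O((log log
X)^(−1/6))) (HeathBrownActa2001, tree theorem), X = (N/6)^(1/3),
so U = Σ hbWeight ≍ σ₀6^(−2/3)η²N and A has N^(2/3−o(1)) elements ≤ N. Pair sieve: #(p ≤ N : p + h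
prime) ≤ C·(h/φ(h))·N/log²N for 1 ≤ h ≤ N
(tree `primePairs_card_le`; with constant (8+2ε)𝔖(h), BombieriDavenport1966, tree
`primePairs_card_le_four`). Local data: ν_p(r) ≤ 3p,
ν_d(r) ≤ 3^ω(d)d, cw(d) ≤ 2^ω(d) (tree `CubicFormClassCountBounds`); class bound U_d(r) ≤
C₁6^ω(d)η²N/d for d ≤ √(ηX); large-moduli total
N^(1/3+o(1))·ηX·((ηX)^(3/4) + (log N)^9) = N^(11/12+o(1)) vs η²N = N^(1−o(1)). In print: Romanoff's
density for p + 2^k ≥ 0.0868 (ChenSun2004) …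
0.110114 (Elsholtz–Schlage-Puchta, quoted in arXiv:2606.06118 p. 3); no density statement for p +
(prime value of a binary cubic form) exists.

DEFINITION REQUESTS. None: every object is inline over
`Literature.NumberTheory.Sieve.CubicMinorantDefs` (hbWeight, hbEta, hbX). No cite facts wanted (the
line is fact-free).

Novelty: Honesty label of record (director-frontier RULING 2026-08-27T10:20:12Z, D-0061 option (i)): this
route's target `GoldbachHeathBrownPositiveDensity` is the FLOOR rung F-P1c strictly under the F-P1b
leaf `GoldbachHeathBrownDispersion.GoldbachHeathBrownAlmostAll` (the LS desk probe W6,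
tools-ls-desk/probes/W-RomanoffHeathBrown.rev0.lean c80a1a43, sorry-free, std axioms, certifies
`GoldbachHeathBrownAlmostAll → GoldbachHeathBrownPositiveDensity`); it is bankable referee-grade
arithmetic from tree theorems, NOT distance to binary Goldbach / GHL, and its ceiling is declared
(bc9 ladder_ceiling = capped-at-positive-density; the lift = class asymptotics = the sibling's crux
HeathBrownMorozUniform). Ledger FRONTIER, class floor-rung.
Searches (2026-08-27): lit search --hybrid «Romanoff theorem sum of prime and element of sparse set
positive density» (5 held: arXiv:2401.15892,
arXiv:2204.12287, arXiv:2606.06118, arXiv:2403.12874, doi:10.5802/crmath.345 — all powers-of-2 type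
sets); lit search «Romanoff theorem sparse set Chen»
--source all (zbMATH/Crossref: doi:10.1007/s11425-010-3084-x Chen 2010, doi:10.4064/aa135-2-3 Li–Pan
2008; OpenAlex/S2 429); lit vsearch «positive
proportion of integers are a prime plus an element of a thin set of primes» (no relevant hit beyond
the above); lit galaxy search «Romanoff's theorem|Romanov's
theorem|Romanoff theorem» --star all (6: [galaxy:panama:466089850961978] Nathanson GTM 164,
[galaxy:panama:508300789547027] Montgomery–Vaughan,
[galaxy:panama:5  [refs: 10.5802/crmath.345, 10.1007/s11425-010-3084-x, 10.4064/aa135-2-3, 10.4064/aa107-4-1, 2401.15892, 2204.12287, 2606.06118, 2403.12874, 2508.12139, 2508.16400, 0708.2539, doi:10.5802/crmath.345, doi:10.1007/s11425-010-3084-x, doi:10.4064/aa135-2-3, doi:10.4064/aa107-4-1, Romanoff1934, Nathanson1996, Erdos1950, HeathBrownActa2001, HeathBrownMoroz2004]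

Barriers (technique_class: romanoff-energy, upper-bound-sieve, thin-prime-subset): - technique_class: romanoff-energy, upper-bound-sieve, thin-prime-subset
- Literature.Barriers.Parity.CircleMethodBinaryBarrier: outside — no exponential sum, major/minor
arc or pointwise-in-n statement occurs; the conclusion is a positive PROPORTION of n obtained by
Cauchy–Schwarz from two moments, which is exactly the regime the barrier leaves open.
- Literature.Barriers.Parity.RedactedPrimes: outside — the barrier quantifies over one even x with
loose information on S(x,·); here exact weights are averaged over n ≤ 2N and only a lower bound for
the number of represented n is claimed.
- Literature.Barriers.Parity.SelbergParityBarrier: outside — sieves enter only as UPPER bounds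
(prime pairs p, p+h; prime values of x³+2y³ in classes); the primes themselves are supplied by
theorems (Heath-Brown 2001 for x³+2y³, Chebyshev for all primes), never produced by a sieve.
- Literature.Barriers.Parity.EquidistributionLimitBarrier: outside — no equidistribution of
Heath-Brown primes in any residue class is asserted or needed; only upper bounds of the right order
to moduli ≤ √(ηX) ≈ N^(1/6) and lattice counts beyond, so Maier/Granville–Soundararajan
irregularities are not contradicted.
- Literature.Barriers.Parity.UniformBatemanHornBarrier: outside — this is precisely the difference
from the sibling dispersion route: no asymptotic (Bateman–Horn / Heath-Brown–Moroz) in classes is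
used, uniform or not; only sieve upper bounds with unspecified constants.
- Literature.Barriers.Parity.BrunTit

History (route lifecycle, newest last):
- 2026-08-27T10:51:45Z · closes_target -> closes rung F-P1c of Parity: Summit.Parity.GeneralizedHardyLittlewood.Theses.RomanoffHeathBrown.GoldbachHeathBrownPositiveDensity (D-0061; not the summit Statement) (planner-parity-ideate-p2-g9-0)
- 2026-08-27T13:34:39Z · CLOSED proved — proved:Summit.Parity.GeneralizedHardyLittlewood.Theses.RomanoffHeathBrown.goldbachHeathBrownPositiveDensity_proof (planner-parity-ideate-p2-g10-0)

sub-problem: GeneralizedHardyLittlewood · status: closed(proved) · opened planner-parity-ideate-p2-g8-0 2026-08-27T09:57:54Z · rev 3 · ledger route-Parity-RomanoffHeathBrown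
GENERATED by the gate from the ledger (D-0016/17). Provers cite these decls: `theorem foo : Summit.Parity.GeneralizedHardyLittlewood.Theses.RomanoffHeathBrown.<Decl> := …` in Summits/Parity/GeneralizedHardyLittlewood/Theorems/<Name>.lean.
-/

namespace Summit.Parity.GeneralizedHardyLittlewood.Theses.RomanoffHeathBrown

open scoped BigOperators Topology Manifold Classical MeasureTheory ProbabilityTheory Matrix InnerProductSpace ComplexConjugate ContinuousMap
open Filter Set Function TopologicalSpace MeasureTheory

attribute [summit_statement] _root_.GeneralizedHardyLittlewood
-- H21.Audit: the closer leaf Summit.Parity.GeneralizedHardyLittlewood.Theses.RomanoffHeathBrown.GoldbachHeathBrownPositiveDensity is an item decl of this route file — tagged summit_statement below, after its declaration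

/-- item stmt-Parity-20271 · target · rank 0 · closed · proved by Summit.Parity.GeneralizedHardyLittlewood.Theses.RomanoffHeathBrown.goldbachHeathBrownPositiveDensity_proof (prover) · by planner
why it might fail: a density-zero sumset would need the Heath-Brown primes to concentrate on few residue classes to many small moduli (Ding-type examples, arXiv:2401.15892 p. 3) — excluded by the class Brun–Titchmarsh bound; numerically untested.
sources: Romanoff1934, Nathanson1996, HeathBrownActa2001, arXiv:2401.15892
[target] there are c₀ > 0 and N₀ such that for all N ≥ N₀ at least c₀N even integers n ≤ N are p +
(x³+2y³) with p and x³+2y³ prime, x, y ≥ 1. -/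
@[route_item "route-Parity-RomanoffHeathBrown"]
def GoldbachHeathBrownPositiveDensity : Prop :=
  ∃ c₀ : ℝ, 0 < c₀ ∧ ∃ N₀ : ℕ, ∀ N : ℕ, N₀ ≤ N → c₀ * (N : ℝ) ≤ ((Finset.filter (fun n : ℕ => Even n ∧ ∃ p x y : ℕ, 0 < x ∧ 0 < y ∧ p.Prime ∧ (x ^ 3 + 2 * y ^ 3).Prime ∧ p + (x ^ 3 + 2 * y ^ 3) = n) (Finset.Icc 1 N)).card : ℝ)

-- `GoldbachHeathBrownPositiveDensity` holds: proved by `Summit.Parity.GeneralizedHardyLittlewood.Theses.RomanoffHeathBrown.goldbachHeathBrownPositiveDensity_proof` (its module imports this route file, so no `_holds` link can be stated here).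

/-- item stmt-Parity-20272 · crux · rank 2 · closed · proved by Summit.Parity.GeneralizedHardyLittlewood.Theorems.RomanoffHeathBrown.romanoffHeathBrown_smallModuliCorrelation_proof (prover) · by planner
why it might fail: needs the tree bound's threshold L₀ ≤ hbSide/d and log(hbSide/d) ≫ log N UNIFORMLY for d ≤ √(ηX), and empty non-coprime classes (every Heath-Brown prime > N/2 > d); the d = 1 term alone forces U ≤ Cη²N (true, HeathBrownActa2001) — a mis-normalised η²N vs N^(1/3)·hbSide² would break only constants.
sources: HeathBrownMoroz2004, HeathBrownActa2001, HalberstamRichert1974, Nathanson1996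
[crux] SMALL-MODULI CLASS ENERGY of the Heath-Brown weight u = hbWeight c N (U = Σ_(k≤N) u(k),
U_d(r) = Σ_(k≤N, k≡r (d)) u(k), g(d) = ∏_(p|d) 1/(p−2)): for every c > 0 there are C, N₀ with Σ_(d ≤
√(ηX), d odd squarefree) g(d)·Σ_(r mod d) U_d(r)² ≤ C·(η²N)·U for N ≥ N₀ — from U_d(r) ≤
C₁6^ω(d)η²N/d (class Brun–Titchmarsh, tree `sum_hbWeight_modEq_le`, with ν_d(r) ≤ 3^ω(d)d, cw(d) ≤
2^ω(d), log(hbSide/d) ≥ (1/13)log N, non-coprime classes empty) and Σ_d g(d)6^ω(d)/d < ∞.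
[difficulty: M] -/
@[route_item "route-Parity-RomanoffHeathBrown", crux]
def SmallModuliCorrelation : Prop :=
  ∀ c : ℝ, 0 < c → ∃ C : ℝ, ∃ N₀ : ℕ, ∀ N : ℕ, N₀ ≤ N → (∑ d ∈ (Finset.Icc 1 N).filter (fun d : ℕ => Squarefree d ∧ Odd d ∧ (d : ℝ) ≤ Real.sqrt (Literature.NumberTheory.Sieve.CubicMinorant.hbEta c N * Literature.NumberTheory.Sieve.CubicMinorant.hbX N)), (∏ p ∈ d.primeFactors, (1 : ℝ) / ((p : ℝ) - 2)) * ∑ r ∈ Finset.range d, (∑ k ∈ (Finset.Icc 1 N).filter (fun k : ℕ => k ≡ r [MOD d]), Literature.NumberTheory.Sieve.CubicMinorant.hbWeight c N k) ^ 2) ≤ C * (Literature.NumberTheory.Sieve.CubicMinorant.hbEta c N ^ 2 * N) * ∑ k ∈ Finset.Icc 1 N, Literature.NumberTheory.Sieve.CubicMinorant.hbWeight c N k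

-- `SmallModuliCorrelation` holds: proved by `Summit.Parity.GeneralizedHardyLittlewood.Theorems.RomanoffHeathBrown.romanoffHeathBrown_smallModuliCorrelation_proof` (its module imports this route file, so no `_holds` link can be stated here).

/-- item stmt-Parity-20273 · crux · rank 3 · closed · proved by Summit.Parity.GeneralizedHardyLittlewood.Theorems.RomanoffHeathBrown.romanoffHeathBrown_largeModuliCorrelation_proof (prover) · by planner
why it might fail: the lattice count has no log saving, so the exponent budget 1/3 + 1/3 + (1/3)(3/4) = 11/12 < 1 is the whole margin (N^(1/12−o(1))); a d-range where only ν_d(r)(L/d+1)² (tree `card_pairBox_modEq_le`) were available would give N^(4/3) and break it — the one-y-at-a-time count is essential.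
sources: HalberstamRichert1974, MontgomeryVaughan2007, HeathBrownMoroz2004, arXiv:0708.2539
[crux] LARGE-MODULI CLASS ENERGY: for every c > 0 and ε > 0, for N ≥ N₀, Σ_(√(ηX) < d ≤ N, d odd
squarefree) g(d)·Σ_(r mod d) U_d(r)² ≤ ε·(η²N)·U — by the lattice count U_d(r) ≤ N^(1/3) log
N·3^ω(d)(ηX+2)((ηX+1)/d + 1) (for each y the x with x³ ≡ r − 2y³ lie in ≤ 3^ω(d) classes mod
squarefree d; tree `card_Ioc_filter_cube_modEq_le`), g(d) ≤ 3^ω(d)/d, the Rankin tail Σ_(d>D)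
9^ω(d)/d² ≪ D^(−1/2) and Σ_(d≤N) 9^ω(d)/d ≪ (log N)^9: total N^(11/12+o(1))·U = o(η²N·U).
[difficulty: M] -/
@[route_item "route-Parity-RomanoffHeathBrown", crux]
def LargeModuliCorrelation : Prop :=
  ∀ c : ℝ, 0 < c → ∀ ε : ℝ, 0 < ε → ∃ N₀ : ℕ, ∀ N : ℕ, N₀ ≤ N → (∑ d ∈ (Finset.Icc 1 N).filter (fun d : ℕ => Squarefree d ∧ Odd d ∧ Real.sqrt (Literature.NumberTheory.Sieve.CubicMinorant.hbEta c N * Literature.NumberTheory.Sieve.CubicMinorant.hbX N) < d), (∏ p ∈ d.primeFactors, (1 : ℝ) / ((p : ℝ) - 2)) * ∑ r ∈ Finset.range d, (∑ k ∈ (Finset.Icc 1 N).filter (fun k : ℕ => k ≡ r [MOD d]), Literature.NumberTheory.Sieve.CubicMinorant.hbWeight c N k) ^ 2) ≤ ε * (Literature.NumberTheory.Sieve.CubicMinorant.hbEta c N ^ 2 * N) * ∑ k ∈ Finset.Icc 1 N, Literature.NumberTheory.Sieve.CubicMinorant.hbWeight c N k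

-- `LargeModuliCorrelation` holds: proved by `Summit.Parity.GeneralizedHardyLittlewood.Theorems.RomanoffHeathBrown.romanoffHeathBrown_largeModuliCorrelation_proof` (its module imports this route file, so no `_holds` link can be stated here).

/-- item stmt-Parity-20274 · support · rank 9 · closed · proved by Summit.Parity.GeneralizedHardyLittlewood.Theses.RomanoffHeathBrown.hbMassLower_proof (prover) · by planner
sources: HeathBrownActa2001, HeathBrownMoroz2004
[support] MASS of the Heath-Brown weight: there are a box exponent c > 0 (Heath-Brown's), c₁ > 0 and
N₀ with U = Σ_(k≤N) hbWeight c N k ≥ c₁·η²N for N ≥ N₀ — from the kernel theorem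
`CubicPrimes.HeathBrown2001_primePairCount_asymptotic_holds` (#primePairs ~ σ₀η²X²/(3 log X), X³ =
N/6) exactly as in the Theorems file `HeathBrownPrimeAP3.mass_ge` / `VinogradovHeathBrownMainTerm`
(have hmass). [difficulty: S] -/
@[route_item "route-Parity-RomanoffHeathBrown", crux]
def HBMassLower : Prop :=
  ∃ c : ℝ, 0 < c ∧ ∃ c₁ : ℝ, 0 < c₁ ∧ ∃ N₀ : ℕ, ∀ N : ℕ, N₀ ≤ N → c₁ * (Literature.NumberTheory.Sieve.CubicMinorant.hbEta c N ^ 2 * N) ≤ ∑ k ∈ Finset.Icc 1 N, Literature.NumberTheory.Sieve.CubicMinorant.hbWeight c N k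

-- `HBMassLower` holds: proved by `Summit.Parity.GeneralizedHardyLittlewood.Theses.RomanoffHeathBrown.hbMassLower_proof` (its module imports this route file, so no `_holds` link can be stated here).

/-- item stmt-Parity-20275 · support · rank 9 · closed · proved by Summit.Parity.GeneralizedHardyLittlewood.Theses.RomanoffHeathBrown.secondMomentReduction_proof (prover) · by planner
sources: Nathanson1996, Romanoff1934, BombieriDavenport1966, MontgomeryVaughan2007, arXiv:0708.2539
[support] PAIR-SIEVE REDUCTION of the second moment: with θ_N(m) = log m on odd primes m ≤ N (else
0) and R(n) = Σ_(k≤N) u(k)θ_N(n−k), for every c > 0 there are C, N₀ with Σ_(n≤2N) R(n)² ≤ C·(N log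
N)·(N^(1/3) log N·(ηX+2))·U + C·N·Σ_(d≤N odd squarefree) g(d) Σ_(r mod d) U_d(r)² (N ≥ N₀): diagonal
T(0) = Σ_(p≤N)(log p)² ≤ log 4·N log N (Mathlib `Chebyshev.theta_le_log4_mul_x`) times max u ≤
N^(1/3) log N·(ηX+2); a shift h = |k−k′| ≥ 1 costs ≤ (log N)²·#(p ≤ N : p+h prime) ≤ C·N·h/φ(h)
(tree `primePairs_card_le`; or 𝔖(h) via `PrimePairSieve.primePairs_card_le_four`) and h/φ(h) =
Σ_(d|h) μ²(d)/φ(d) ≤ 2Σ_(d|h, d odd squarefree) g(d) (tree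
`Romanov.selfDivTotient_eq_sum_divisors`); dropping k ≠ k′ gives the class energies — the tree's
`RomanovTheorem.lean` §5 (`card_primePairsShift_le`, `card_primePowTwoQuadruples_le`) is the
template. [difficulty: M] -/
@[route_item "route-Parity-RomanoffHeathBrown", crux]
def SecondMomentReduction : Prop :=
  ∀ c : ℝ, 0 < c → ∃ C : ℝ, ∃ N₀ : ℕ, ∀ N : ℕ, N₀ ≤ N → ∑ n ∈ Finset.Icc 1 (2 * N), (∑ k ∈ Finset.Icc 1 N, Literature.NumberTheory.Sieve.CubicMinorant.hbWeight c N k * (if (n - k).Prime ∧ Odd (n - k) ∧ n - k ≤ N then Real.log ((n - k : ℕ) : ℝ) else 0)) ^ 2 ≤ C * ((N : ℝ) * Real.log N) * ((N : ℝ) ^ ((1 : ℝ) / 3) * Real.log N * (Literature.NumberTheory.Sieve.CubicMinorant.hbEta c N * Literature.NumberTheory.Sieve.CubicMinorant.hbX N + 2)) * ∑ k ∈ Finset.Icc 1 N, Literature.NumberTheory.Sieve.CubicMinorant.hbWeight c N k + C * (N : ℝ) * ∑ d ∈ (Finset.Icc 1 N).filter (fun d : ℕ => Squarefree d ∧ Odd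 d), (∏ p ∈ d.primeFactors, (1 : ℝ) / ((p : ℝ) - 2)) * ∑ r ∈ Finset.range d, (∑ k ∈ (Finset.Icc 1 N).filter (fun k : ℕ => k ≡ r [MOD d]), Literature.NumberTheory.Sieve.CubicMinorant.hbWeight c N k) ^ 2

-- `SecondMomentReduction` holds: proved by `Summit.Parity.GeneralizedHardyLittlewood.Theses.RomanoffHeathBrown.secondMomentReduction_proof` (its module imports this route file, so no `_holds` link can be stated here).

/-- item stmt-Parity-20276 · assembly · rank 1 · closed · proved by Summit.Parity.GeneralizedHardyLittlewood.Theses.RomanoffHeathBrown.assembly_proof (prover) · by planner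
sources: Nathanson1996, Romanoff1934, HeathBrownActa2001
[assembly] SmallModuliCorrelation → LargeModuliCorrelation → HBMassLower → SecondMomentReduction →
GoldbachHeathBrownPositiveDensity (the composition just described; kind assembly, an M-sized
Romanoff/Cauchy–Schwarz item served to provers — the tree's `Romanov.romanov` §6 is the template). -/
@[route_item "route-Parity-RomanoffHeathBrown", crux]
def Assembly : Prop :=
  SmallModuliCorrelation → LargeModuliCorrelation → HBMassLower → SecondMomentReduction → GoldbachHeathBrownPositiveDensity

-- `Assembly` holds: proved by `Summit.Parity.GeneralizedHardyLittlewood.Theses.RomanoffHeathBrown.assembly_proof` (its module imports this route file, so no `_holds` link can be stated here).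

attribute [summit_statement] _root_.Summit.Parity.GeneralizedHardyLittlewood.Theses.RomanoffHeathBrown.GoldbachHeathBrownPositiveDensity

/-! D-0027 §2.1 — DECIDING THEOREM (planner-authored via `route open/edit --closes-file`; by planner-parity-ideate-p2-g9-0 2026-08-27T10:51:45Z) — ARCHIVED: route closed (proved) 2026-08-27T13:34:35Z; kept so importers keep building:
its hypotheses are this route's items and its conclusion the registered leaf `Summit.Parity.GeneralizedHardyLittlewood.Theses.RomanoffHeathBrown.GoldbachHeathBrownPositiveDensity` (rung F-P1c, D-0061) (glue_lint), and it elaborates with this file. -/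

/-! D-0027 §2.1 deciding theorem of route RomanoffHeathBrown (D-0061 option (i): the conclusion is the route's own
rank-0 target item `GoldbachHeathBrownPositiveDensity`, to be registered as an ALT-CLOSER rung leaf F-P1c of
Parity/GeneralizedHardyLittlewood — it is implied in one line by the registered leaf F-P1b
`GoldbachHeathBrownDispersion.GoldbachHeathBrownAlmostAll`). Romanoff's second-moment argument that composes the four
blocks is the `Assembly` item (kind assembly, served to provers like any statement); `closes` applies it, so every
declared item is in the cone (BC6). -/

@[closes "route-Parity-RomanoffHeathBrown"] theorem closes (hA : Assembly) (h₁ : SmallModuliCorrelation) (h₂ : LargeModuliCorrelation) (h₃ : HBMassLower)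
    (h₄ : SecondMomentReduction) : GoldbachHeathBrownPositiveDensity :=
  hA h₁ h₂ h₃ h₄

end Summit.Parity.GeneralizedHardyLittlewood.Theses.RomanoffHeathBrown
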